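import Summits.Ventures.QEC.Census.TwoBGA.TwoBGAOneSided02
import Summits.Ventures.QEC.Census.TwoBGA.TwoBGAOneSided03
import Summits.Ventures.QEC.Census.BB.BBRows
import Summits.Ventures.QEC.Census.BB.Claims
import Literature.InformationTheory.QuantumCodes.TwoBlockConnectedComponents
import Literature.InformationTheory.QuantumCodes.TwoBlockToricLayout
import Literature.InformationTheory.QuantumCodes.TwoBlockWheelComponents
import Literature.InformationTheory.QuantumCodes.TwoBlockRootParameters
import HarnessLib
import HarnessLib.Audit.Tags

/-!
# Census rows as TYPED two-block codes `QC(A, B)` on `ℤ_ℓ × ℤ_m` — bridge batch `TwoBGAOneSidedQC02` (3 row(s), kernel tier)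

Family: abelian two-block over ℤ_ℓ × ℤ_m (qec census one-module KERNEL-std rows: qec-search-7 certificate modules, MITM and
Brouwer–Zimmermann/automorphism formats). For each census row below (an EXPLICIT matrix code
`cert.code _ = CSSCode.ofMatrices (rowMatrix n cert.HX) (rowMatrix n cert.HZ)` with `IsCode n k d` certified in its own module), this file
puts the row's CONSTRUCTION into the kernel statement, as in the pilot `Census/BB/A1s_n144_k32_4addf704QC.lean` (p511732) and the
gen-4 batches `A1sRowsQC1–5` / `TwoBGARowsQC1–4`: monomial lists `la`, `lb` (from the certificate's construction record — the
docstring's `A_terms`/`B_terms` or the census row id `2bga-lℓmm-A…-B…`, monomials `xⁱyʲ` as `[i,j]`, convention of BCGMRY24 §4 =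
`BivariateBicycleCodes.lean`; the index identity was ALSO re-verified row-for-row by the emitter before filing), the typed object
`qc : BB.Code ℓ m := ⟨polyL la, polyL lb⟩`, the kernel INDEX IDENTITIES `cert.HX = BBRows.rowsX la lb`, `cert.HZ = BBRows.rowsZ la lb`
(`decide`; verified row generator `Census/BB/BBRows.lean`, p502918), the flat identities via `BBRows.rowMatrix_rowsX/Z`, the transport of
the row's own `dZ_eq` and `k` (its `k_eq`, or the `k`-component of its `isCode`) by type-05's `BB.Code.dZ_eq_of_flat` / `k_eq_of_flat` to
`qc_hasParams : BB.HasParams qc n k d` (census predicate of family BB, `Census/BB/Claims.lean`, distance EXACT) and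
`qc_isCode : qc.css.IsCode n k d`; and the census LAYOUT columns (Bravyi et al. 2024 §4 — arXiv:2308.07915: Lemma 2 p0010 L49, Lemma 3 p0011 L9, Lemma 4 p0011 L28; locators per qec-ref-2 2026-08-27T10:27Z) as KERNEL verdicts: «connected» —
`qc_tannerGraph_connected` (Lemma 3, `BB.Code.tannerGraph_connected_of_unit_mem`, explicit multiples of exponent differences) or
`qc_tannerGraph_not_connected` + `card_expDiffSubgroup` + `qc_card_connectedComponent` (`⟨S⟩` = an explicit finite carrier `diffList`,
both inclusions certified; exact component count by Lemma 3 (ii), `BB.Code.card_connectedComponent_mul_card`; by the tree's connected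
normal form `TwoBlockConnectedComponents.lean` such a code is the disjoint union of that many copies of its root code, whose parameters
`[[n/c, k/c, d]]` and connectedness are certified here as `root_isCode` via `TwoBlockRootParameters.lean`); «toric layout» —
`qc_hasToricLayoutWith μ λ` (Lemma 4, `BB.Code.hasToricLayoutWith_of_exponents`; omitted when its sufficient condition has no witness);
«wheel layers» — `qc_wheel_layers` (Lemma 2 minus planarity, `BB.Code.exists_wheel_layers`, weight-(3,3) rows only):

* `TB_l2m18_A0_0_0_1_1_4_1_7_B0_0_0_1_1_9_1_14` = `QC(1 + y + xy^4 + xy^7, 1 + y + xy^9 + xy^14)` on `ℤ_2 × ℤ_18`: `[[72, 6, 10]]`; Tanner graph connected; toric layout (18,2)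
* `S8_3x12_w6_k8_000105` = `QC(1 + y + y^5, 1 + x + x^2y^9)` on `ℤ_3 × ℤ_12`: `[[72, 8, 8]]`; Tanner graph connected; toric layout (12,3); wheel layers 6/6
* `S8_2x20_w6_k6_0016B00` = `QC(1 + xy^6, 1 + y + xy^4 + xy^9)` on `ℤ_2 × ℤ_20`: `[[80, 6, 10]]`; Tanner graph connected; toric layout (10,4)

No new certificate — tier KERNEL, axioms standard, no `native_decide`. HONEST FRAMING: identifies already-certified census objects with
named algebraic constructions and decides structural (graph) properties; the census comparator columns (printed values, optimality
words) are not touched; for disconnected rows the root code is identified abstractly over `↥⟨S⟩` (not re-indexed to a named `QC(A',B')`,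
not identified with a smaller census row); planarity/thickness is not asserted. Generated by
qec-type-05 gen 6's `tools/emit_qc_bridge3.py` (gen 5's emitter + sibling-data rows + ℓ = 1 connectivity) + `tools/conn_cert.py` (HOME/lean/type-05/tools/).
-/

namespace Summit.Ventures.QEC.Census.TB_l2m18_A0_0_0_1_1_4_1_7_B0_0_0_1_1_9_1_14

open Matrix Literature.InformationTheory.QuantumCodes BBRows

/-- Monomials of `A = 1 + y + xy^4 + xy^7` (construction `A_terms = [[0, 0], [0, 1], [1, 4], [1, 7]]`, from the census row id `2bga-l2m18-A0-0.0-1.1-4.1-7-B0-0.0-1.1-9.1-14` named in the row module). DATA. -/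
def la : List (BB.Mono 2 18) := [(Fin.ofNat 2 0, Fin.ofNat 18 0), (Fin.ofNat 2 0, Fin.ofNat 18 1), (Fin.ofNat 2 1, Fin.ofNat 18 4), (Fin.ofNat 2 1, Fin.ofNat 18 7)]

/-- Monomials of `B = 1 + y + xy^9 + xy^14` (construction `B_terms = [[0, 0], [0, 1], [1, 9], [1, 14]]`). DATA. -/
def lb : List (BB.Mono 2 18) := [(Fin.ofNat 2 0, Fin.ofNat 18 0), (Fin.ofNat 2 0, Fin.ofNat 18 1), (Fin.ofNat 2 1, Fin.ofNat 18 9), (Fin.ofNat 2 1, Fin.ofNat 18 14)]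

/-- The census row's code as a TYPED two-block code `QC(1 + y + xy^4 + xy^7, 1 + y + xy^9 + xy^14)` on `ℤ_2 × ℤ_18` (`BB.Code 2 18`). (definition) -/
def qc : BB.Code 2 18 := ⟨polyL la, polyL lb⟩

set_option maxRecDepth 100000 in
/-- INDEX IDENTITY, `X` side, in the kernel: the certificate's `H^X` rows ARE the `X`-check words of `qc` (`decide +kernel`). -/
theorem HX_eq_rowsX : TB_l2m18_A0_0_0_1_1_4_1_7_B0_0_0_1_1_9_1_14.cert.HX = rowsX la lb := by
  decide +kernel

set_option maxRecDepth 100000 in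
/-- INDEX IDENTITY, `Z` side. -/
theorem HZ_eq_rowsZ : TB_l2m18_A0_0_0_1_1_4_1_7_B0_0_0_1_1_9_1_14.cert.HZ = rowsZ la lb := by
  decide +kernel

set_option maxRecDepth 100000 in
/-- The certificate's flat `H^X` is `qc.HXFlat`. -/
theorem rowMatrix_HX_eq : rowMatrix 72 TB_l2m18_A0_0_0_1_1_4_1_7_B0_0_0_1_1_9_1_14.cert.HX = qc.HXFlat := by
  have cast : ∀ {H H' : List ℕ} (e : H = H'),
      rowMatrix 72 H = (rowMatrix 72 H').submatrix (Fin.cast (congrArg List.length e)) id := by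
    intro H H' e; subst e; rfl
  exact (cast HX_eq_rowsX).trans (rowMatrix_rowsX qc (LA := la) (LB := lb) rfl rfl)

set_option maxRecDepth 100000 in
/-- The certificate's flat `H^Z` is `qc.HZFlat`. -/
theorem rowMatrix_HZ_eq : rowMatrix 72 TB_l2m18_A0_0_0_1_1_4_1_7_B0_0_0_1_1_9_1_14.cert.HZ = qc.HZFlat := by
  have cast : ∀ {H H' : List ℕ} (e : H = H'),
      rowMatrix 72 H = (rowMatrix 72 H').submatrix (Fin.cast (congrArg List.length e)) id := by
    intro H H' e; subst e; rfl
  exact (cast HZ_eq_rowsZ).trans (rowMatrix_rowsZ qc (LA := la) (LB := lb) rfl rfl)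

set_option maxRecDepth 100000 in
/-- `d^Z (qc) = 10`, transported from the census certificate (`TB_l2m18_A0_0_0_1_1_4_1_7_B0_0_0_1_1_9_1_14.dZ_eq`) by `BB.Code.dZ_eq_of_flat`. -/
theorem qc_dZ : qc.css.dZ = 10 :=
  (qc.dZ_eq_of_flat (D := TB_l2m18_A0_0_0_1_1_4_1_7_B0_0_0_1_1_9_1_14.cert.code (TB_l2m18_A0_0_0_1_1_4_1_7_B0_0_0_1_1_9_1_14.cert.commOK_of_checkStructure TB_l2m18_A0_0_0_1_1_4_1_7_B0_0_0_1_1_9_1_14.checkStructure_ok))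
    rowMatrix_HX_eq rowMatrix_HZ_eq).symm.trans TB_l2m18_A0_0_0_1_1_4_1_7_B0_0_0_1_1_9_1_14.dZ_eq

set_option maxRecDepth 100000 in
/-- `k (qc) = 6`, transported from the census certificate (the `k`-component of `TB_l2m18_A0_0_0_1_1_4_1_7_B0_0_0_1_1_9_1_14.isCode`) by `BB.Code.k_eq_of_flat`. -/
theorem qc_k : qc.k = 6 :=
  (qc.k_eq_of_flat (D := TB_l2m18_A0_0_0_1_1_4_1_7_B0_0_0_1_1_9_1_14.cert.code (TB_l2m18_A0_0_0_1_1_4_1_7_B0_0_0_1_1_9_1_14.cert.commOK_of_checkStructure TB_l2m18_A0_0_0_1_1_4_1_7_B0_0_0_1_1_9_1_14.checkStructure_ok))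
    rowMatrix_HX_eq rowMatrix_HZ_eq).symm.trans TB_l2m18_A0_0_0_1_1_4_1_7_B0_0_0_1_1_9_1_14.isCode.2.1

/-- **`QC(1 + y + xy^4 + xy^7, 1 + y + xy^9 + xy^14)` on `ℤ_2 × ℤ_18` has parameters `[[72, 6, 10]]`** (distance exact; `BB.HasParams`) — the census row
`TB_l2m18_A0_0_0_1_1_4_1_7_B0_0_0_1_1_9_1_14` read as a statement about the construction. KERNEL. -/
theorem qc_hasParams : Summit.Ventures.QEC.BB.HasParams qc 72 6 10 :=
  BB.hasParams_of_dZ (by simp only [BB.numQubits_eq]) qc_k qc_dZ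

/-- The same in the generic census vocabulary: `qc.css.IsCode 72 6 10`. -/
theorem qc_isCode : qc.css.IsCode 72 6 10 :=
  (BB.hasParams_iff_isCode (by decide)).1 qc_hasParams

set_option maxRecDepth 100000 in
/-- **The Tanner graph of `qc` is connected** (Bravyi et al. 2024 Lemma 3 / `BB.Code.tannerGraph_connected_of_unit_mem`): `x = (1,0)`
and `y = (0,1)` are explicit combinations of exponent differences inside `A` or inside `B` (found by qec-type-05's tools/conn_cert.py,
re-checked by `decide`). Census column «connected» for this row, KERNEL. -/
theorem qc_tannerGraph_connected : qc.css.tannerGraph.Connected := by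
  refine qc.tannerGraph_connected_of_unit_mem (fun h => absurd (congrFun h ((0 : Fin 2), (0 : Fin 18))) (by decide))
    (fun h => absurd (congrFun h ((0 : Fin 2), (0 : Fin 18))) (by decide)) ?_ ?_
  · have e : (((1 : Fin 2), (0 : Fin 18)) : BB.Mono 2 18) = (9 : ℕ) • ((((0 : Fin 2), (0 : Fin 18))) - (1, 4)) := by decide
    rw [e]
    exact (AddSubgroup.nsmul_mem _ (qc.sub_mem_expDiffSubgroup_A (by decide) (by decide)) 9)
  · have e : (((0 : Fin 2), (1 : Fin 18)) : BB.Mono 2 18) = (17 : ℕ) • ((((0 : Fin 2), (0 : Fin 18))) - (0, 1)) := by decide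
    rw [e]
    exact (AddSubgroup.nsmul_mem _ (qc.sub_mem_expDiffSubgroup_A (by decide) (by decide)) 17)

set_option maxRecDepth 100000 in
/-- **`qc` has a toric layout with `(μ, λ) = (18, 2)`** (Bravyi et al. 2024 Lemma 4 / `BB.Code.hasToricLayoutWith_of_exponents`): the two layout
generators `A_iA_jᵀ ↦ (0, 0) − (0, 1)` and `B_gB_hᵀ ↦ (0, 0) − (1, 9)` generate `ℤ_2 × ℤ_18` generate the group
(explicit multiples giving `x` and `y`) and have orders `18` and `2` (product `36 = ℓm`). — both facts `decide`d as LOCAL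
steps (they mention no row constant, so as separate theorems they would restate the same statement across rows). Census
layout column, KERNEL. -/
theorem qc_hasToricLayoutWith : HasToricLayoutWith 18 2 qc.css.tannerGraph := by
  have hgen : AddSubgroup.closure ({((0 : Fin 2), (0 : Fin 18)) - (0, 1), ((0 : Fin 2), (0 : Fin 18)) - (1, 9)} : Set (BB.Mono 2 18)) = ⊤ := by
    apply BB.Code.addSubgroup_eq_top_of_unit_mem
    · have h1 := AddSubgroup.subset_closure (k := ({((0 : Fin 2), (0 : Fin 18)) - (0, 1), ((0 : Fin 2), (0 : Fin 18)) - (1, 9)} : Set (BB.Mono 2 18))) (Set.mem_insert _ _)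
      have h2 := AddSubgroup.subset_closure (k := ({((0 : Fin 2), (0 : Fin 18)) - (0, 1), ((0 : Fin 2), (0 : Fin 18)) - (1, 9)} : Set (BB.Mono 2 18))) (Set.mem_insert_of_mem _ rfl)
      have e : (9 : ℕ) • (((0 : Fin 2), (0 : Fin 18)) - (0, 1)) + (1 : ℕ) • (((0 : Fin 2), (0 : Fin 18)) - (1, 9)) = (1, 0) := by decide
      have h' := AddSubgroup.add_mem _ (AddSubgroup.nsmul_mem _ h1 9) (AddSubgroup.nsmul_mem _ h2 1)
      rw [e] at h'
      exact h'
    · have h1 := AddSubgroup.subset_closure (k := ({((0 : Fin 2), (0 : Fin 18)) - (0, 1), ((0 : Fin 2), (0 : Fin 18)) - (1, 9)} : Set (BB.Mono 2 18))) (Set.mem_insert _ _)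
      have h2 := AddSubgroup.subset_closure (k := ({((0 : Fin 2), (0 : Fin 18)) - (0, 1), ((0 : Fin 2), (0 : Fin 18)) - (1, 9)} : Set (BB.Mono 2 18))) (Set.mem_insert_of_mem _ rfl)
      have e : (17 : ℕ) • (((0 : Fin 2), (0 : Fin 18)) - (0, 1)) + (0 : ℕ) • (((0 : Fin 2), (0 : Fin 18)) - (1, 9)) = (0, 1) := by decide
      have h' := AddSubgroup.add_mem _ (AddSubgroup.nsmul_mem _ h1 17) (AddSubgroup.nsmul_mem _ h2 0)
      rw [e] at h'
      exact h'
  have hord : addOrderOf (((0 : Fin 2), (0 : Fin 18)) - (0, 1)) = 18 ∧ addOrderOf (((0 : Fin 2), (0 : Fin 18)) - (1, 9)) = 2 :=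
    ⟨(addOrderOf_eq_iff (by norm_num)).mpr (by decide), (addOrderOf_eq_iff (by norm_num)).mpr (by decide)⟩
  have h := qc.hasToricLayoutWith_of_exponents (g := ((0 : Fin 2), (0 : Fin 18))) (g' := (0, 1))
    (h := ((0 : Fin 2), (0 : Fin 18))) (h' := (1, 9)) (by decide) (by decide) (by decide) (by decide)
    hgen (by rw [hord.1, hord.2])
  rwa [hord.1, hord.2] at h

/-- `qc` has a toric layout. KERNEL. -/
theorem qc_hasToricLayout : HasToricLayout qc.css.tannerGraph :=
  ⟨18, 2, by norm_num, by norm_num, qc_hasToricLayoutWith⟩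

end Summit.Ventures.QEC.Census.TB_l2m18_A0_0_0_1_1_4_1_7_B0_0_0_1_1_9_1_14

namespace Summit.Ventures.QEC.Census.S8_3x12_w6_k8_000105

open Matrix Literature.InformationTheory.QuantumCodes BBRows

/-- Monomials of `A = 1 + y + y^5` (construction `A_terms = [[0, 0], [0, 1], [0, 5]]`, from the census row id `2bga-l3m12-A0-0.0-1.0-5-B0-0.1-0.2-9` named in the row module). DATA. -/
def la : List (BB.Mono 3 12) := [(Fin.ofNat 3 0, Fin.ofNat 12 0), (Fin.ofNat 3 0, Fin.ofNat 12 1), (Fin.ofNat 3 0, Fin.ofNat 12 5)]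

/-- Monomials of `B = 1 + x + x^2y^9` (construction `B_terms = [[0, 0], [1, 0], [2, 9]]`). DATA. -/
def lb : List (BB.Mono 3 12) := [(Fin.ofNat 3 0, Fin.ofNat 12 0), (Fin.ofNat 3 1, Fin.ofNat 12 0), (Fin.ofNat 3 2, Fin.ofNat 12 9)]

/-- The census row's code as a TYPED two-block code `QC(1 + y + y^5, 1 + x + x^2y^9)` on `ℤ_3 × ℤ_12` (`BB.Code 3 12`). (definition) -/
def qc : BB.Code 3 12 := ⟨polyL la, polyL lb⟩

set_option maxRecDepth 100000 in
/-- INDEX IDENTITY, `X` side, in the kernel: the certificate's `H^X` rows ARE the `X`-check words of `qc` (`decide +kernel`). -/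
theorem HX_eq_rowsX : S8_3x12_w6_k8_000105.cert.HX = rowsX la lb := by
  decide +kernel

set_option maxRecDepth 100000 in
/-- INDEX IDENTITY, `Z` side. -/
theorem HZ_eq_rowsZ : S8_3x12_w6_k8_000105.cert.HZ = rowsZ la lb := by
  decide +kernel

set_option maxRecDepth 100000 in
/-- The certificate's flat `H^X` is `qc.HXFlat`. -/
theorem rowMatrix_HX_eq : rowMatrix 72 S8_3x12_w6_k8_000105.cert.HX = qc.HXFlat := by
  have cast : ∀ {H H' : List ℕ} (e : H = H'),
      rowMatrix 72 H = (rowMatrix 72 H').submatrix (Fin.cast (congrArg List.length e)) id := by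
    intro H H' e; subst e; rfl
  exact (cast HX_eq_rowsX).trans (rowMatrix_rowsX qc (LA := la) (LB := lb) rfl rfl)

set_option maxRecDepth 100000 in
/-- The certificate's flat `H^Z` is `qc.HZFlat`. -/
theorem rowMatrix_HZ_eq : rowMatrix 72 S8_3x12_w6_k8_000105.cert.HZ = qc.HZFlat := by
  have cast : ∀ {H H' : List ℕ} (e : H = H'),
      rowMatrix 72 H = (rowMatrix 72 H').submatrix (Fin.cast (congrArg List.length e)) id := by
    intro H H' e; subst e; rfl
  exact (cast HZ_eq_rowsZ).trans (rowMatrix_rowsZ qc (LA := la) (LB := lb) rfl rfl)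

set_option maxRecDepth 100000 in
/-- `d^Z (qc) = 8`, transported from the census certificate (`S8_3x12_w6_k8_000105.dZ_eq`) by `BB.Code.dZ_eq_of_flat`. -/
theorem qc_dZ : qc.css.dZ = 8 :=
  (qc.dZ_eq_of_flat (D := S8_3x12_w6_k8_000105.cert.code (S8_3x12_w6_k8_000105.cert.commOK_of_checkStructure S8_3x12_w6_k8_000105.checkStructure_ok))
    rowMatrix_HX_eq rowMatrix_HZ_eq).symm.trans S8_3x12_w6_k8_000105.dZ_eq

set_option maxRecDepth 100000 in
/-- `k (qc) = 8`, transported from the census certificate (the `k`-component of `S8_3x12_w6_k8_000105.isCode`) by `BB.Code.k_eq_of_flat`. -/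
theorem qc_k : qc.k = 8 :=
  (qc.k_eq_of_flat (D := S8_3x12_w6_k8_000105.cert.code (S8_3x12_w6_k8_000105.cert.commOK_of_checkStructure S8_3x12_w6_k8_000105.checkStructure_ok))
    rowMatrix_HX_eq rowMatrix_HZ_eq).symm.trans S8_3x12_w6_k8_000105.isCode.2.1

/-- **`QC(1 + y + y^5, 1 + x + x^2y^9)` on `ℤ_3 × ℤ_12` has parameters `[[72, 8, 8]]`** (distance exact; `BB.HasParams`) — the census row
`S8_3x12_w6_k8_000105` read as a statement about the construction. KERNEL. -/
theorem qc_hasParams : Summit.Ventures.QEC.BB.HasParams qc 72 8 8 :=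
  BB.hasParams_of_dZ (by simp only [BB.numQubits_eq]) qc_k qc_dZ

/-- The same in the generic census vocabulary: `qc.css.IsCode 72 8 8`. -/
theorem qc_isCode : qc.css.IsCode 72 8 8 :=
  (BB.hasParams_iff_isCode (by decide)).1 qc_hasParams

set_option maxRecDepth 100000 in
/-- **The Tanner graph of `qc` is connected** (Bravyi et al. 2024 Lemma 3 / `BB.Code.tannerGraph_connected_of_unit_mem`): `x = (1,0)`
and `y = (0,1)` are explicit combinations of exponent differences inside `A` or inside `B` (found by qec-type-05's tools/conn_cert.py,
re-checked by `decide`). Census column «connected» for this row, KERNEL. -/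
theorem qc_tannerGraph_connected : qc.css.tannerGraph.Connected := by
  refine qc.tannerGraph_connected_of_unit_mem (fun h => absurd (congrFun h ((0 : Fin 3), (0 : Fin 12))) (by decide))
    (fun h => absurd (congrFun h ((0 : Fin 3), (0 : Fin 12))) (by decide)) ?_ ?_
  · have e : (((1 : Fin 3), (0 : Fin 12)) : BB.Mono 3 12) = (2 : ℕ) • ((((0 : Fin 3), (0 : Fin 12))) - (1, 0)) := by decide
    rw [e]
    exact (AddSubgroup.nsmul_mem _ (qc.sub_mem_expDiffSubgroup_B (by decide) (by decide)) 2)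
  · have e : (((0 : Fin 3), (1 : Fin 12)) : BB.Mono 3 12) = (11 : ℕ) • ((((0 : Fin 3), (0 : Fin 12))) - (0, 1)) := by decide
    rw [e]
    exact (AddSubgroup.nsmul_mem _ (qc.sub_mem_expDiffSubgroup_A (by decide) (by decide)) 11)

set_option maxRecDepth 100000 in
/-- **`qc` has a toric layout with `(μ, λ) = (12, 3)`** (Bravyi et al. 2024 Lemma 4 / `BB.Code.hasToricLayoutWith_of_exponents`): the two layout
generators `A_iA_jᵀ ↦ (0, 0) − (0, 1)` and `B_gB_hᵀ ↦ (0, 0) − (1, 0)` generate `ℤ_3 × ℤ_12` generate the group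
(explicit multiples giving `x` and `y`) and have orders `12` and `3` (product `36 = ℓm`). — both facts `decide`d as LOCAL
steps (they mention no row constant, so as separate theorems they would restate the same statement across rows). Census
layout column, KERNEL. -/
theorem qc_hasToricLayoutWith : HasToricLayoutWith 12 3 qc.css.tannerGraph := by
  have hgen : AddSubgroup.closure ({((0 : Fin 3), (0 : Fin 12)) - (0, 1), ((0 : Fin 3), (0 : Fin 12)) - (1, 0)} : Set (BB.Mono 3 12)) = ⊤ := by
    apply BB.Code.addSubgroup_eq_top_of_unit_mem
    · have h1 := AddSubgroup.subset_closure (k := ({((0 : Fin 3), (0 : Fin 12)) - (0, 1), ((0 : Fin 3), (0 : Fin 12)) - (1, 0)} : Set (BB.Mono 3 12))) (Set.mem_insert _ _)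
      have h2 := AddSubgroup.subset_closure (k := ({((0 : Fin 3), (0 : Fin 12)) - (0, 1), ((0 : Fin 3), (0 : Fin 12)) - (1, 0)} : Set (BB.Mono 3 12))) (Set.mem_insert_of_mem _ rfl)
      have e : (0 : ℕ) • (((0 : Fin 3), (0 : Fin 12)) - (0, 1)) + (2 : ℕ) • (((0 : Fin 3), (0 : Fin 12)) - (1, 0)) = (1, 0) := by decide
      have h' := AddSubgroup.add_mem _ (AddSubgroup.nsmul_mem _ h1 0) (AddSubgroup.nsmul_mem _ h2 2)
      rw [e] at h'
      exact h'
    · have h1 := AddSubgroup.subset_closure (k := ({((0 : Fin 3), (0 : Fin 12)) - (0, 1), ((0 : Fin 3), (0 : Fin 12)) - (1, 0)} : Set (BB.Mono 3 12))) (Set.mem_insert _ _)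
      have h2 := AddSubgroup.subset_closure (k := ({((0 : Fin 3), (0 : Fin 12)) - (0, 1), ((0 : Fin 3), (0 : Fin 12)) - (1, 0)} : Set (BB.Mono 3 12))) (Set.mem_insert_of_mem _ rfl)
      have e : (11 : ℕ) • (((0 : Fin 3), (0 : Fin 12)) - (0, 1)) + (0 : ℕ) • (((0 : Fin 3), (0 : Fin 12)) - (1, 0)) = (0, 1) := by decide
      have h' := AddSubgroup.add_mem _ (AddSubgroup.nsmul_mem _ h1 11) (AddSubgroup.nsmul_mem _ h2 0)
      rw [e] at h'
      exact h'
  have hord : addOrderOf (((0 : Fin 3), (0 : Fin 12)) - (0, 1)) = 12 ∧ addOrderOf (((0 : Fin 3), (0 : Fin 12)) - (1, 0)) = 3 :=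
    ⟨(addOrderOf_eq_iff (by norm_num)).mpr (by decide), (addOrderOf_eq_iff (by norm_num)).mpr (by decide)⟩
  have h := qc.hasToricLayoutWith_of_exponents (g := ((0 : Fin 3), (0 : Fin 12))) (g' := (0, 1))
    (h := ((0 : Fin 3), (0 : Fin 12))) (h' := (1, 0)) (by decide) (by decide) (by decide) (by decide)
    hgen (by rw [hord.1, hord.2])
  rwa [hord.1, hord.2] at h

/-- `qc` has a toric layout. KERNEL. -/
theorem qc_hasToricLayout : HasToricLayout qc.css.tannerGraph :=
  ⟨12, 3, by norm_num, by norm_num, qc_hasToricLayoutWith⟩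

set_option maxRecDepth 100000 in
/-- **`qc`**: Tanner graph = edge-disjoint union of two layers whose components are wheel graphs `prismGraph 6` (`A₃A₂ᵀ` of order
`3`) and `prismGraph 6` (`B₂B₁ᵀ` of order `3`) — BCGMRY24 Lemma 2 minus planarity (`BB.Code.exists_wheel_layers`). KERNEL. -/
theorem qc_wheel_layers :
    ∃ ΓA ΓB : SimpleGraph ((BB.Mono 3 12 ⊕ BB.Mono 3 12) ⊕ (BB.Mono 3 12 ⊕ BB.Mono 3 12)),
    qc.css.tannerGraph = ΓA ⊔ ΓB ∧ Disjoint ΓA ΓB ∧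
    (∀ K : ΓA.ConnectedComponent, Nonempty (K.toSimpleGraph ≃g prismGraph 6)) ∧
    (∀ K : ΓB.ConnectedComponent, Nonempty (K.toSimpleGraph ≃g prismGraph 6)) := by
  have hA : ∀ g : BB.Mono 3 12, qc.A g ≠ 0 ↔ g = ((0 : Fin 3), (0 : Fin 12)) ∨ g = ((0 : Fin 3), (1 : Fin 12)) ∨ g = ((0 : Fin 3), (5 : Fin 12)) := by decide +kernel
  have hB : ∀ g : BB.Mono 3 12, qc.B g ≠ 0 ↔ g = ((0 : Fin 3), (0 : Fin 12)) ∨ g = ((1 : Fin 3), (0 : Fin 12)) ∨ g = ((2 : Fin 3), (9 : Fin 12)) := by decide +kernel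
  have h := qc.exists_wheel_layers (g₁ := ((0 : Fin 3), (0 : Fin 12))) (g₂ := ((0 : Fin 3), (1 : Fin 12))) (g₃ := ((0 : Fin 3), (5 : Fin 12))) (h₁ := ((0 : Fin 3), (0 : Fin 12)))
    (h₂ := ((1 : Fin 3), (0 : Fin 12))) (h₃ := ((2 : Fin 3), (9 : Fin 12))) (by decide) (by decide) (by decide) (by decide) (by decide) (by decide) hA hB
  have e1 : addOrderOf (((0 : Fin 3), (5 : Fin 12)) - (0, 1)) = 3 := (addOrderOf_eq_iff (by norm_num)).mpr (by decide)
  have e2 : addOrderOf (((1 : Fin 3), (0 : Fin 12)) - (0, 0)) = 3 := (addOrderOf_eq_iff (by norm_num)).mpr (by decide)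
  rw [e1, e2] at h
  exact h

end Summit.Ventures.QEC.Census.S8_3x12_w6_k8_000105

namespace Summit.Ventures.QEC.Census.S8_2x20_w6_k6_0016B00

open Matrix Literature.InformationTheory.QuantumCodes BBRows

/-- Monomials of `A = 1 + xy^6` (construction `A_terms = [[0, 0], [1, 6]]`, from the census row id `2bga-l2m20-A0-0.1-6-B0-0.0-1.1-4.1-9` named in the row module). DATA. -/
def la : List (BB.Mono 2 20) := [(Fin.ofNat 2 0, Fin.ofNat 20 0), (Fin.ofNat 2 1, Fin.ofNat 20 6)]

/-- Monomials of `B = 1 + y + xy^4 + xy^9` (construction `B_terms = [[0, 0], [0, 1], [1, 4], [1, 9]]`). DATA. -/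
def lb : List (BB.Mono 2 20) := [(Fin.ofNat 2 0, Fin.ofNat 20 0), (Fin.ofNat 2 0, Fin.ofNat 20 1), (Fin.ofNat 2 1, Fin.ofNat 20 4), (Fin.ofNat 2 1, Fin.ofNat 20 9)]

/-- The census row's code as a TYPED two-block code `QC(1 + xy^6, 1 + y + xy^4 + xy^9)` on `ℤ_2 × ℤ_20` (`BB.Code 2 20`). (definition) -/
def qc : BB.Code 2 20 := ⟨polyL la, polyL lb⟩

set_option maxRecDepth 100000 in
/-- INDEX IDENTITY, `X` side, in the kernel: the certificate's `H^X` rows ARE the `X`-check words of `qc` (`decide +kernel`). -/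
theorem HX_eq_rowsX : S8_2x20_w6_k6_0016B00.cert.HX = rowsX la lb := by
  decide +kernel

set_option maxRecDepth 100000 in
/-- INDEX IDENTITY, `Z` side. -/
theorem HZ_eq_rowsZ : S8_2x20_w6_k6_0016B00.cert.HZ = rowsZ la lb := by
  decide +kernel

set_option maxRecDepth 100000 in
/-- The certificate's flat `H^X` is `qc.HXFlat`. -/
theorem rowMatrix_HX_eq : rowMatrix 80 S8_2x20_w6_k6_0016B00.cert.HX = qc.HXFlat := by
  have cast : ∀ {H H' : List ℕ} (e : H = H'),
      rowMatrix 80 H = (rowMatrix 80 H').submatrix (Fin.cast (congrArg List.length e)) id := by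
    intro H H' e; subst e; rfl
  exact (cast HX_eq_rowsX).trans (rowMatrix_rowsX qc (LA := la) (LB := lb) rfl rfl)

set_option maxRecDepth 100000 in
/-- The certificate's flat `H^Z` is `qc.HZFlat`. -/
theorem rowMatrix_HZ_eq : rowMatrix 80 S8_2x20_w6_k6_0016B00.cert.HZ = qc.HZFlat := by
  have cast : ∀ {H H' : List ℕ} (e : H = H'),
      rowMatrix 80 H = (rowMatrix 80 H').submatrix (Fin.cast (congrArg List.length e)) id := by
    intro H H' e; subst e; rfl
  exact (cast HZ_eq_rowsZ).trans (rowMatrix_rowsZ qc (LA := la) (LB := lb) rfl rfl)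

set_option maxRecDepth 100000 in
/-- `d^Z (qc) = 10`, transported from the census certificate (`S8_2x20_w6_k6_0016B00.dZ_eq`) by `BB.Code.dZ_eq_of_flat`. -/
theorem qc_dZ : qc.css.dZ = 10 :=
  (qc.dZ_eq_of_flat (D := S8_2x20_w6_k6_0016B00.cert.code (S8_2x20_w6_k6_0016B00.cert.commOK_of_checkStructure S8_2x20_w6_k6_0016B00.checkStructure_ok))
    rowMatrix_HX_eq rowMatrix_HZ_eq).symm.trans S8_2x20_w6_k6_0016B00.dZ_eq

set_option maxRecDepth 100000 in
/-- `k (qc) = 6`, transported from the census certificate (the `k`-component of `S8_2x20_w6_k6_0016B00.isCode`) by `BB.Code.k_eq_of_flat`. -/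
theorem qc_k : qc.k = 6 :=
  (qc.k_eq_of_flat (D := S8_2x20_w6_k6_0016B00.cert.code (S8_2x20_w6_k6_0016B00.cert.commOK_of_checkStructure S8_2x20_w6_k6_0016B00.checkStructure_ok))
    rowMatrix_HX_eq rowMatrix_HZ_eq).symm.trans S8_2x20_w6_k6_0016B00.isCode.2.1

/-- **`QC(1 + xy^6, 1 + y + xy^4 + xy^9)` on `ℤ_2 × ℤ_20` has parameters `[[80, 6, 10]]`** (distance exact; `BB.HasParams`) — the census row
`S8_2x20_w6_k6_0016B00` read as a statement about the construction. KERNEL. -/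
theorem qc_hasParams : Summit.Ventures.QEC.BB.HasParams qc 80 6 10 :=
  BB.hasParams_of_dZ (by simp only [BB.numQubits_eq]) qc_k qc_dZ

/-- The same in the generic census vocabulary: `qc.css.IsCode 80 6 10`. -/
theorem qc_isCode : qc.css.IsCode 80 6 10 :=
  (BB.hasParams_iff_isCode (by decide)).1 qc_hasParams

set_option maxRecDepth 100000 in
/-- **The Tanner graph of `qc` is connected** (Bravyi et al. 2024 Lemma 3 / `BB.Code.tannerGraph_connected_of_unit_mem`): `x = (1,0)`
and `y = (0,1)` are explicit combinations of exponent differences inside `A` or inside `B` (found by qec-type-05's tools/conn_cert.py,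
re-checked by `decide`). Census column «connected» for this row, KERNEL. -/
theorem qc_tannerGraph_connected : qc.css.tannerGraph.Connected := by
  refine qc.tannerGraph_connected_of_unit_mem (fun h => absurd (congrFun h ((0 : Fin 2), (0 : Fin 20))) (by decide))
    (fun h => absurd (congrFun h ((0 : Fin 2), (0 : Fin 20))) (by decide)) ?_ ?_
  · have e : (((1 : Fin 2), (0 : Fin 20)) : BB.Mono 2 20) = (5 : ℕ) • ((((0 : Fin 2), (0 : Fin 20))) - (1, 4)) := by decide
    rw [e]
    exact (AddSubgroup.nsmul_mem _ (qc.sub_mem_expDiffSubgroup_B (by decide) (by decide)) 5)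
  · have e : (((0 : Fin 2), (1 : Fin 20)) : BB.Mono 2 20) = (19 : ℕ) • ((((0 : Fin 2), (0 : Fin 20))) - (0, 1)) := by decide
    rw [e]
    exact (AddSubgroup.nsmul_mem _ (qc.sub_mem_expDiffSubgroup_B (by decide) (by decide)) 19)

set_option maxRecDepth 100000 in
/-- **`qc` has a toric layout with `(μ, λ) = (10, 4)`** (Bravyi et al. 2024 Lemma 4 / `BB.Code.hasToricLayoutWith_of_exponents`): the two layout
generators `A_iA_jᵀ ↦ (0, 0) − (1, 6)` and `B_gB_hᵀ ↦ (1, 4) − (1, 9)` generate `ℤ_2 × ℤ_20` generate the group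
(explicit multiples giving `x` and `y`) and have orders `10` and `4` (product `40 = ℓm`). — both facts `decide`d as LOCAL
steps (they mention no row constant, so as separate theorems they would restate the same statement across rows). Census
layout column, KERNEL. -/
theorem qc_hasToricLayoutWith : HasToricLayoutWith 10 4 qc.css.tannerGraph := by
  have hgen : AddSubgroup.closure ({((0 : Fin 2), (0 : Fin 20)) - (1, 6), ((1 : Fin 2), (4 : Fin 20)) - (1, 9)} : Set (BB.Mono 2 20)) = ⊤ := by
    apply BB.Code.addSubgroup_eq_top_of_unit_mem
    · have h1 := AddSubgroup.subset_closure (k := ({((0 : Fin 2), (0 : Fin 20)) - (1, 6), ((1 : Fin 2), (4 : Fin 20)) - (1, 9)} : Set (BB.Mono 2 20))) (Set.mem_insert _ _)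
      have h2 := AddSubgroup.subset_closure (k := ({((0 : Fin 2), (0 : Fin 20)) - (1, 6), ((1 : Fin 2), (4 : Fin 20)) - (1, 9)} : Set (BB.Mono 2 20))) (Set.mem_insert_of_mem _ rfl)
      have e : (5 : ℕ) • (((0 : Fin 2), (0 : Fin 20)) - (1, 6)) + (2 : ℕ) • (((1 : Fin 2), (4 : Fin 20)) - (1, 9)) = (1, 0) := by decide
      have h' := AddSubgroup.add_mem _ (AddSubgroup.nsmul_mem _ h1 5) (AddSubgroup.nsmul_mem _ h2 2)
      rw [e] at h'
      exact h'
    · have h1 := AddSubgroup.subset_closure (k := ({((0 : Fin 2), (0 : Fin 20)) - (1, 6), ((1 : Fin 2), (4 : Fin 20)) - (1, 9)} : Set (BB.Mono 2 20))) (Set.mem_insert _ _)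
      have h2 := AddSubgroup.subset_closure (k := ({((0 : Fin 2), (0 : Fin 20)) - (1, 6), ((1 : Fin 2), (4 : Fin 20)) - (1, 9)} : Set (BB.Mono 2 20))) (Set.mem_insert_of_mem _ rfl)
      have e : (4 : ℕ) • (((0 : Fin 2), (0 : Fin 20)) - (1, 6)) + (3 : ℕ) • (((1 : Fin 2), (4 : Fin 20)) - (1, 9)) = (0, 1) := by decide
      have h' := AddSubgroup.add_mem _ (AddSubgroup.nsmul_mem _ h1 4) (AddSubgroup.nsmul_mem _ h2 3)
      rw [e] at h'
      exact h'
  have hord : addOrderOf (((0 : Fin 2), (0 : Fin 20)) - (1, 6)) = 10 ∧ addOrderOf (((1 : Fin 2), (4 : Fin 20)) - (1, 9)) = 4 :=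
    ⟨(addOrderOf_eq_iff (by norm_num)).mpr (by decide), (addOrderOf_eq_iff (by norm_num)).mpr (by decide)⟩
  have h := qc.hasToricLayoutWith_of_exponents (g := ((0 : Fin 2), (0 : Fin 20))) (g' := (1, 6))
    (h := ((1 : Fin 2), (4 : Fin 20))) (h' := (1, 9)) (by decide) (by decide) (by decide) (by decide)
    hgen (by rw [hord.1, hord.2])
  rwa [hord.1, hord.2] at h

/-- `qc` has a toric layout. KERNEL. -/
theorem qc_hasToricLayout : HasToricLayout qc.css.tannerGraph :=
  ⟨10, 4, by norm_num, by norm_num, qc_hasToricLayoutWith⟩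

end Summit.Ventures.QEC.Census.S8_2x20_w6_k6_0016B00
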